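import Literature.MathematicalPhysics.QuantumFieldTheory.Balaban1983to89.B13ConditionedTermKernels
import Literature.MathematicalPhysics.QuantumFieldTheory.Balaban1983to89.NodeOLettersOfWalksWitnessSym

/-!
# `Balaban1983to89.B13ConditionedWitness` — T. Bałaban, *Renormalization group approach to lattice gauge field theories.
II. Cluster expansions*, Commun. Math. Phys. **116** (1988) 1–22 [Balaban1988RG2Cluster], p. 3, (1.11) p. 5, (2.5)–(2.7)
pp. 12–13, p. 15: NON-VACUITY OF THE CONDITIONED RUNG IN PRINT's FORM — the hypothesis list of the N10 junction
`Summit…N10AtRecord11B13WalksBlockMonomialHolo` (ONE operator per term with ONE joint walk expansion whose terms are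
`s`-monomials with a walk REVERSAL, ONE reference positivity, a real positive definite reference value) is inhabited,
torus-uniformly, by the GENUINELY σ- AND u-DEPENDENT symmetric operators `μ·1 + H(σ,u) + H(σ,u)ᵀ` built from ANY
one-step local family `H` whose terms all carry a parameter (`B13LocalKernelWalks.LocalTerms`), read as ONE conditioned
operator through the constructor `B13ConditionedTermKernels.condKernels`

statement-level bookkeeping over published theorems with citation tags; finite-matrix MODELS on the unit torus, kernel-
checked; nothing here is a claim about the Yang–Mills mass gap.

WHY (cell `pub-ymgap`, D-0062 Track A, node N10 = [B13]; seat `pub-ymgap-dag-n10-c` g3, module 22).  Modules 17–21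
reduce N10's per-term NODE-A hypothesis to the data of ONE operator in print's form.  A referee's (A2) question — is that
hypothesis list jointly satisfiable NON-DEGENERATELY (σ-dependent, u-dependent, non-trivial off-diagonal block, symmetric,
torus-uniform constants)? — is answered here by a GENERIC construction over the tree's witness machinery
(`NodeOLettersOfWalksWitness.jointWalkExpansion_massLocal`, `NodeOLettersOfWalksWitnessSym.append`): the SYMMETRIZATION
`H ⊕ Hᵀ` of a local family (the transposed datum swaps start and end sites and transposes the entry patterns; [13]
(3.107): a reversed walk gives the transposed term), whose juxtaposed term family carries the reversal `Sum.swap`.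

WHAT THIS FILE PROVIDES.
§1 `transposeData H` (abbrev; `x ↔ y`, `M ↦ Mᵀ`, same monomials and coefficients), `transposeData_term` (its terms are
   the transposed terms), `isLocal_transposeData` (locality letters, given a fibre bound of the END sites of `H`);
   `symmetrize H := append H (transposeData H)`, `symmetrize_kernel` (`= H.kernel + H.kernelᵀ`), `symmetrize_term_swap`
   (`T_{swap ω} = T_ωᵀ`), `isLocal_symmetrize`.
§2 `massLocal_symmetrize_zero` — if every term of `H` carries a parameter, `μ·1 + H(0,u) + H(0,u)ᵀ = μ·1 =
   (diagonal μ).map ofReal` (the REAL reference value; positive definite for `μ > 0`, `posDef_diagonal_const`);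
   `refAcc_massLocal_symmetrize_zero` (`μ`-positivity of `Re K(0,0)`); `massLocal_symmetrize_sub_zero` (NON-DEGENERACY:
   `K(σ,u) − K(0,0) = H(σ,u) + H(σ,u)ᵀ` — the operator sees σ and u exactly as much as `H` does).
§3 ★ `structuredExpansion_massLocal_symmetrize` — PRINT's FORM: the joint walk expansion of `μ·1 + H ⊕ Hᵀ` through `X`
   (`jointWalkExpansion_massLocal`, constants `(R, 2, κ, μ + K̄_loc)` free of the torus) has `s`-MONOMIAL terms
   (`J := ∅` for the mass term, `H`'s `J_b` for the hopping terms) and the REVERSAL `Equiv.sumCongr (refl Unit) (sumComm B B)`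
   — exactly the `∃ W T SX A D ρ J T0 rev, …` of module 21's binder `hKexp` (at any reference package whose full-precision
   letters are these).
§4 ★ `termWalksRef_condKernels_massLocal_symmetrize` — the conditioned record `condKernels c (μ·1 + H ⊕ Hᵀ) (diagonal μ) …`
   carries NODE A's reference rung `TermWalksRef` for every reference package dominated by the model's letters
   (`B13ConditionedTermKernels.termWalksRef_condKernels`): the conditioned rung is inhabited by a genuinely non-local,
   σ- and u-dependent symmetric operator on EVERY torus with the SAME constants.
HONEST FRAMING: MODELS — finite matrices on the unit torus certifying that the hypothesis SHAPE of N10's reduced NODE-A input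
is inhabited non-degenerately and NOTHING ELSE; whether Bałaban's `C*Δ_k(σ,𝐔,𝐉)C` admits such an expansion with k-uniform
constants at complex backgrounds is NODE A ([13] Thms 3.10∕3.12; node N06 s4 ∕ row (D4)), untouched.  Count-neutral; NOT a
discharge of N10; two MODEL `abbrev`s with bodies, no `Prop` placeholder, no instance, no notation; 0 `sorry`; standard
axioms; nothing continuum ∕ ℝ⁴ ∕ OS ∕ mass gap ∕ Clay.
-/

noncomputable section

namespace Literature.MathematicalPhysics.QuantumFieldTheory.Balaban1983to89.B13ConditionedWitness

open Metric Set Finset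
open scoped Matrix
open Literature.MathematicalPhysics.QuantumFieldTheory.Balaban1983to89
open Literature.MathematicalPhysics.QuantumFieldTheory.Balaban1983to89.B9Thm37GlueTorus (tdist1 tdist1_comm)
open Literature.MathematicalPhysics.QuantumFieldTheory.Balaban1983to89.TreeLengthTorus (TPt)
open Literature.MathematicalPhysics.QuantumFieldTheory.Balaban1983to89.B5TorusCover (UT)
open Literature.MathematicalPhysics.QuantumFieldTheory.Balaban1983to89.B13JointWalkExpansion (JointWalkExpansion)
open Literature.MathematicalPhysics.QuantumFieldTheory.Balaban1983to89.B13LocalKernelWalks (LocalTerms)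
open Literature.MathematicalPhysics.QuantumFieldTheory.Balaban1983to89.B13TermWalkData (TermKernels)
open Literature.MathematicalPhysics.QuantumFieldTheory.Balaban1983to89.NodeOLettersOfWalksPerturbative
  (RefPackage TermWalksRef)
open Literature.MathematicalPhysics.QuantumFieldTheory.Balaban1983to89.NodeOLettersOfWalksWitness
  (massLocal kbarLoc jointWalkExpansion_massLocal)
open Literature.MathematicalPhysics.QuantumFieldTheory.Balaban1983to89.NodeOLettersOfWalksWitnessSym
  (append append_kernel append_term_inl append_term_inr isLocal_append)
open Literature.MathematicalPhysics.QuantumFieldTheory.Balaban1983to89.B13ConditionedTermKernels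
  (condKernels termWalksRef_condKernels)

variable {d N' : ℕ} {ν : ℕ} {Nf : Fin ν → ℕ} [∀ i, NeZero (Nf i)]
variable {E : Type*} [NormedAddCommGroup E] [NormedSpace ℂ E]
variable {q : Type} [Fintype q] [DecidableEq q]

/-! ## §1. The transposed datum and the symmetrization of a one-step local family -/

/-- MODEL. **THE TRANSPOSED ONE-STEP DATUM**: start and end sites swapped, entry patterns transposed, the same
`s`-monomials and coefficients ([13] (3.107): the reversed one-step walk `(y_b, x_b)` carries the transposed term).
[cite: Balaban1985BackgroundPropagators, (3.107) p.416; Balaban1988RG2Cluster, (1.11) p.5] -/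
abbrev transposeData (H : LocalTerms d N' ν Nf q q E) : LocalTerms d N' ν Nf q q E where
  B := H.B
  instFintype := inferInstance
  x := H.y
  y := H.x
  J := H.J
  coef := H.coef
  M := fun b => (H.M b)ᵀ

variable (H : LocalTerms d N' ν Nf q q E)

omit [Fintype q] [DecidableEq q] in
/-- The terms of the transposed datum are the transposed terms. [cite: Balaban1985BackgroundPropagators, (3.107) p.416] -/
theorem transposeData_term (b : H.B) (σ : TPt d N' → ℂ) (u : E) :
    (transposeData H).term b σ u = (H.term b σ u)ᵀ := by
  simp only [LocalTerms.term, Matrix.transpose_smul]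

omit [Fintype q] [DecidableEq q] in
/-- **LOCALITY OF THE TRANSPOSED DATUM** for a square family located by one map `loc` on rows and columns: the letters
`(X, R, λ, r, m_J)` are kept; the multiplicity becomes a fibre bound `n_B′` of the END sites of `H` (a hypothesis).
[cite: Balaban1988RG2Cluster, (1.11) p.5, p.13, p.15; Balaban1985BackgroundPropagators, Thm 3.10 p.416] -/
theorem isLocal_transposeData {c : B13.Consts} {loc : q → UT Nf} {X : Finset (UT Nf)} {R lam r : ℝ} {mJ nB nB' : ℕ}
    (h : H.IsLocal c loc loc X R lam r mJ nB)
    (hy : ∀ z : UT Nf, (Finset.univ.filter fun b => H.y b = z).card ≤ nB') :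
    (transposeData H).IsLocal c loc loc X R lam r mJ nB' where
  hMle b i j := by
    show ‖(H.M b)ᵀ i j‖ ≤ 1
    rw [Matrix.transpose_apply]; exact h.hMle b j i
  hMsupp b i j hne := by
    have hne' : H.M b j i ≠ 0 := hne
    exact ⟨(h.hMsupp b j i hne').2, (h.hMsupp b j i hne').1⟩
  hcoef_an := h.hcoef_an
  hcoef_bd := h.hcoef_bd
  hrange b := by
    show tdist1 Nf (H.y b) (H.x b) ≤ r
    rw [tdist1_comm]; exact h.hrange b
  hJ := h.hJ
  hX b hb := (h.hX b hb).symm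
  hmult := hy

/-- MODEL. **THE SYMMETRIZATION `H ⊕ Hᵀ`** of a one-step local family: the juxtaposition (`NodeOLettersOfWalksWitnessSym.append`)
of the datum and its transpose — the family of the kernel `H(σ,u) + H(σ,u)ᵀ`. [cite: Balaban1985BackgroundPropagators, (3.107) p.416; Balaban1988RG2Cluster, p.15] -/
abbrev symmetrize : LocalTerms d N' ν Nf q q E := append H (transposeData H)

omit [Fintype q] [DecidableEq q] in
/-- The kernel of the symmetrization is `H + Hᵀ`. [cite: Balaban1985BackgroundPropagators, (3.107) p.416] -/
theorem symmetrize_kernel (σ : TPt d N' → ℂ) (u : E) :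
    (symmetrize H).kernel σ u = H.kernel σ u + (H.kernel σ u)ᵀ := by
  rw [symmetrize, append_kernel]
  congr 1
  simp only [LocalTerms.kernel, Matrix.transpose_sum, transposeData_term]

omit [Fintype q] [DecidableEq q] in
/-- **THE REVERSAL OF THE SYMMETRIZED FAMILY**: swapping the two halves transposes the term. [cite: Balaban1985BackgroundPropagators, (3.107) p.416] -/
theorem symmetrize_term_swap (ω : H.B ⊕ H.B) (σ : TPt d N' → ℂ) (u : E) :
    (symmetrize H).term (Equiv.sumComm H.B H.B ω) σ u = ((symmetrize H).term ω σ u)ᵀ := by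
  rcases ω with b | b
  · show (transposeData H).term b σ u = (H.term b σ u)ᵀ
    exact transposeData_term H b σ u
  · show H.term b σ u = ((transposeData H).term b σ u)ᵀ
    rw [transposeData_term, Matrix.transpose_transpose]

omit [Fintype q] [DecidableEq q] in
/-- Locality letters of the symmetrization: multiplicities add (`n_B + n_B′`). [cite: Balaban1988RG2Cluster, (1.11) p.5, p.13, p.15] -/
theorem isLocal_symmetrize {c : B13.Consts} {loc : q → UT Nf} {X : Finset (UT Nf)} {R lam r : ℝ} {mJ nB nB' : ℕ}
    (h : H.IsLocal c loc loc X R lam r mJ nB)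
    (hy : ∀ z : UT Nf, (Finset.univ.filter fun b => H.y b = z).card ≤ nB') :
    (symmetrize H).IsLocal c loc loc X R lam r mJ (nB + nB') :=
  isLocal_append h (isLocal_transposeData H h hy)

/-! ## §2. The reference value: real, positive, and the non-degeneracy -/

omit [Fintype q] [DecidableEq q] in
/-- A term carrying a parameter vanishes at `σ = 0`. [cite: Balaban1988RG2Cluster, (1.11) p.5] -/
theorem term_zero_of_nonempty (L : LocalTerms d N' ν Nf q q E) (b : L.B) (hb : (L.J b).Nonempty) (u : E) :
    L.term b 0 u = 0 := by
  obtain ⟨j, hj⟩ := hb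
  have h0 : (∏ j ∈ L.J b, (0 : TPt d N' → ℂ) j) = 0 := Finset.prod_eq_zero hj rfl
  simp only [LocalTerms.term, h0, zero_mul, zero_smul]

omit [Fintype q] [DecidableEq q] in
/-- The kernel of a family all of whose terms carry a parameter vanishes at `σ = 0` (the reference configuration of the
σ-decoration). [cite: Balaban1988RG2Cluster, (1.11) p.5, p.15] -/
theorem kernel_zero_of_forall_nonempty (L : LocalTerms d N' ν Nf q q E) (hJ : ∀ b, (L.J b).Nonempty) (u : E) :
    L.kernel 0 u = 0 := by
  simp only [LocalTerms.kernel, term_zero_of_nonempty L _ (hJ _) u, Finset.sum_const_zero]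

variable (Nf)

/-- **THE REFERENCE VALUE OF THE MODEL IS REAL**: if every term of `H` carries a parameter, `μ·1 + (H ⊕ Hᵀ)(0,u) =
(diagonal μ).map ofReal` — the real symmetric reference operator of print p. 15. [cite: Balaban1988RG2Cluster, p.15] -/
theorem massLocal_symmetrize_zero (μ : ℝ) (hJ : ∀ b, (H.J b).Nonempty) (u : E) :
    massLocal (d := d) (N' := N') Nf μ (symmetrize H) 0 u
      = (Matrix.diagonal fun _ : q => μ).map (algebraMap ℝ ℂ) := by
  have hJ' : ∀ b : (symmetrize H).B, ((symmetrize H).J b).Nonempty := by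
    rintro (b | b) <;> exact hJ b
  show (μ : ℂ) • (1 : Matrix q q ℂ) + (symmetrize H).kernel 0 u = _
  rw [kernel_zero_of_forall_nonempty _ hJ', add_zero, Matrix.diagonal_map (map_zero _)]
  ext i j
  simp [Matrix.one_apply, Matrix.diagonal_apply]

/-- **NON-DEGENERACY**: the model operator deviates from its reference value by exactly `H(σ,u) + H(σ,u)ᵀ` — it depends
on σ and on the configuration as much as `H` does (no collapse to a constant). [cite: Balaban1988RG2Cluster, (2.16) p.16] -/
theorem massLocal_symmetrize_sub_zero (μ : ℝ) (hJ : ∀ b, (H.J b).Nonempty) (σ : TPt d N' → ℂ) (u u₀ : E) :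
    massLocal (d := d) (N' := N') Nf μ (symmetrize H) σ u - massLocal (d := d) (N' := N') Nf μ (symmetrize H) 0 u₀
      = H.kernel σ u + (H.kernel σ u)ᵀ := by
  have hJ' : ∀ b : (symmetrize H).B, ((symmetrize H).J b).Nonempty := by
    rintro (b | b) <;> exact hJ b
  show (μ : ℂ) • (1 : Matrix q q ℂ) + (symmetrize H).kernel σ u - ((μ : ℂ) • 1 + (symmetrize H).kernel 0 u₀) = _
  rw [kernel_zero_of_forall_nonempty _ hJ', add_zero, add_sub_cancel_left, symmetrize_kernel]

variable {Nf}

omit [Fintype q] in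
/-- `diagonal μ ≻ 0` for `μ > 0`. [folklore] -/
private theorem posDef_diagonal_const {μ : ℝ} (hμ : 0 < μ) [Fintype q] :
    (Matrix.diagonal fun _ : q => μ).PosDef :=
  Matrix.posDef_diagonal_iff.2 fun _ => hμ

/-- **THE REFERENCE POSITIVITY** `Re K(0,0) ≥ μ` of the model (`K(0,0) = μ·1`). [cite: Balaban1988RG2Cluster, p.15] -/
theorem refAcc_massLocal_symmetrize_zero (μ : ℝ) (hJ : ∀ b, (H.J b).Nonempty) (v : q → ℂ) :
    μ * ∑ i, ‖v i‖ ^ 2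
      ≤ (∑ i, star (v i) * (massLocal (d := d) (N' := N') Nf μ (symmetrize H) 0 (0 : E) *ᵥ v) i).re := by
  rw [massLocal_symmetrize_zero Nf H μ hJ (0 : E)]
  refine B13ConditionedTermKernels.refAcc_of_real _ (fun x => le_of_eq ?_) v
  simp only [Matrix.mulVec_diagonal, pow_two]
  rw [Finset.mul_sum]
  exact Finset.sum_congr rfl fun i _ => by ring

/-! ## §3. Print's form: `s`-monomial terms with a reversal -/

/-- **THE JOINT WALK EXPANSION OF THE MODEL IN PRINT's FORM** (what module 21's binder `hKexp` asks, at letters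
`(R, 2, κ, μ + K̄_loc(λ, r, κ+3, n_B + n_B′))` free of the torus): for a local square family `H` (monomial degree `≤ 1`,
coefficient bound `λ ≥ 0`, range `r`, multiplicity `n_B`, end-site multiplicity `n_B′`) and `μ, κ ≥ 0`, the operator
`μ·1 + H ⊕ Hᵀ` carries a joint walk expansion through `X` (`jointWalkExpansion_massLocal` for the symmetrization) whose
terms are `s`-MONOMIALS times σ-free operators and whose term family carries the REVERSAL swapping the two halves.
[cite: Balaban1988RG2Cluster, p.3, (1.11) p.5, p.13, p.15; Balaban1985BackgroundPropagators, Thm 3.10 (3.107)–(3.108) p.416] -/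
theorem structuredExpansion_massLocal_symmetrize (c : B13.Consts) (hκ₁ : 0 ≤ c.κ₁)
    {loc : q → UT Nf} {X : Finset (UT Nf)} {R lam r : ℝ} {nB nB' : ℕ}
    (hH : H.IsLocal c loc loc X R lam r 1 nB) (hy : ∀ z : UT Nf, (Finset.univ.filter fun b => H.y b = z).card ≤ nB')
    (hlam : 0 ≤ lam) {μ : ℝ} (hμ : 0 ≤ μ) {kap : ℝ} (hkap : 0 ≤ kap) :
    ∃ (W : Type) (T : W → (TPt d N' → ℂ) → E → Matrix q q ℂ) (SX : Set W) (A : W → ℝ) (D : W → UT Nf → UT Nf → ℝ)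
      (ρ : ℝ) (J : W → Finset (TPt d N')) (T0 : W → E → Matrix q q ℂ) (rev : W ≃ W),
      JointWalkExpansion c loc loc (massLocal (d := d) (N' := N') Nf μ (symmetrize H)) X R 2 kap
          (μ + kbarLoc c lam r (kap + 3) (nB + nB') ν) T SX A D ρ ∧
        (∀ ω σ u, T ω σ u = (∏ j ∈ J ω, σ j) • T0 ω u) ∧ (∀ ω σ u i j, T (rev ω) σ u i j = T ω σ u j i) := by
  have hS := isLocal_symmetrize H hH hy
  refine ⟨Unit ⊕ (symmetrize H).B, _, _, _, _, _,
    Sum.elim (fun _ => ∅) (symmetrize H).J,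
    Sum.elim (fun _ _ => (μ : ℂ) • (1 : Matrix q q ℂ)) (fun b u => (symmetrize H).coef b u • (symmetrize H).M b),
    Equiv.sumCongr (Equiv.refl Unit) (Equiv.sumComm H.B H.B),
    jointWalkExpansion_massLocal c hκ₁ hS hlam hμ hkap, ?_, ?_⟩
  · rintro (w | b) σ u
    · simp
    · show (symmetrize H).term b σ u = (∏ j ∈ (symmetrize H).J b, σ j) • ((symmetrize H).coef b u • (symmetrize H).M b)
      rw [LocalTerms.term, mul_smul]
  · rintro (w | ω) σ u i j
    · show ((μ : ℂ) • (1 : Matrix q q ℂ)) i j = ((μ : ℂ) • (1 : Matrix q q ℂ)) j i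
      simp only [Matrix.smul_apply, Matrix.one_apply]
      by_cases h : i = j
      · subst h; rfl
      · rw [if_neg h, if_neg (Ne.symm h)]
    · show (symmetrize H).term (Equiv.sumComm H.B H.B ω) σ u i j = (symmetrize H).term ω σ u j i
      rw [symmetrize_term_swap, Matrix.transpose_apply]

/-! ## §4. The conditioned rung inhabited, torus-uniformly, by the model -/

/-- **THE CONDITIONED RECORD OF THE MODEL CARRIES NODE A's REFERENCE RUNG**: on any site torus, read the symmetric
model operator `μ·1 + H ⊕ Hᵀ` on the bond set `Λ ⊕ C₀` (`H` a local square family all of whose terms carry a parameter,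
`μ > 0`) as ONE conditioned operator through `condKernels` (reference value `diagonal μ`, positive definite): then
`TermWalksRef (condKernels …) r` holds for EVERY reference package `r` dominated by the model's torus-free letters
(`R`; drops `≤ 2`; rates `≤ κ`; constants `≥ μ + K̄_loc`; `m₀, m_{A,0} ≤ μ`; far-ness; multiplicity of `loc`; dimension) —
`B13ConditionedTermKernels.termWalksRef_condKernels` on §3's expansion and §2's positivity.  The conditioned rung of
modules 17–21 is thus inhabited NON-DEGENERATELY (§2: the operator moves with σ and u exactly as `H + Hᵀ`).
[cite: Balaban1988RG2Cluster, p.3, (1.11) p.5, (2.5)–(2.7) pp.12–13, p.15, (2.16) p.16; Balaban1985BackgroundPropagators, Thm 3.10 p.416, Thm 3.12 p.423] -/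
theorem termWalksRef_condKernels_massLocal_symmetrize (c : B13.Consts) (hκ₁ : 0 ≤ c.κ₁)
    {Λ C₀ : Type} [Fintype Λ] [DecidableEq Λ] [Fintype C₀] [DecidableEq C₀]
    (H : LocalTerms d N' ν Nf (Λ ⊕ C₀) (Λ ⊕ C₀) E) (hJ : ∀ b, (H.J b).Nonempty)
    {loc : Λ ⊕ C₀ → UT Nf} {X : Finset (UT Nf)} (hX : X.Nonempty) {R lam r : ℝ} {nB nB' : ℕ}
    (hH : H.IsLocal c loc loc X R lam r 1 nB) (hy : ∀ z : UT Nf, (Finset.univ.filter fun b => H.y b = z).card ≤ nB')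
    (hlam : 0 ≤ lam) {μ : ℝ} (hμ : 0 < μ) {kap : ℝ} (hkap : 0 ≤ kap)
    (m : ℕ) (hfib : ∀ x : UT Nf, (Finset.univ.filter fun i : Λ => loc (Sum.inl i) = x).card ≤ m)
    {Rσ : ℝ} (hfar : ∀ k : Λ ⊕ C₀, ∀ z ∈ X, Rσ ≤ tdist1 Nf (loc k) z)
    {nL : ℕ} (hmult : ∀ x : UT Nf, (Finset.univ.filter fun k : Λ ⊕ C₀ => loc k = x).card ≤ nL)
    {dm : ℕ} (hdim : ν ≤ dm)
    (r' : RefPackage) (hrR : r'.R ≤ R)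
    (hεL : r'.εL ≤ 2) (hκL : r'.kapL ≤ kap) (hKL : μ + kbarLoc c lam r (kap + 3) (nB + nB') ν ≤ r'.KbarL)
    (hεP : r'.εP ≤ 2) (hκP : r'.kapP ≤ kap) (hKP : μ + kbarLoc c lam r (kap + 3) (nB + nB') ν ≤ r'.KbarP)
    (hεA : r'.εA ≤ 2) (hκA : r'.kapA ≤ kap) (hKA : μ + kbarLoc c lam r (kap + 3) (nB + nB') ν ≤ r'.KbarA)
    (hm₀ : r'.m₀ ≤ μ) (hmA : r'.mA₀ ≤ μ) (hRσ : r'.Rσ ≤ Rσ) (hnB : nL ≤ r'.nB) (hdm : dm ≤ r'.dm) :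
    TermWalksRef
      (condKernels c (massLocal (d := d) (N' := N') Nf μ (symmetrize H)) (Matrix.diagonal fun _ => μ)
        (massLocal_symmetrize_zero Nf H μ hJ (0 : E)) (posDef_diagonal_const hμ) loc X m hfib) r' := by
  obtain ⟨W, T, SX, A, D, ρ, J, T0, rev, hK, _, _⟩ :=
    structuredExpansion_massLocal_symmetrize (E := E) H c hκ₁ hH hy hlam hμ.le hkap
  have hKbar : 0 ≤ μ + kbarLoc c lam r (kap + 3) (nB + nB') ν :=
    add_nonneg hμ.le (NodeOLettersOfWalksWitness.kbarLoc_nonneg c hlam r (kap + 3) (nB + nB') ν)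
  exact termWalksRef_condKernels hX hK hKbar (refAcc_massLocal_symmetrize_zero H μ hJ) hfar hmult hdim r' hrR
    hεL hκL hKL hεP hκP hKP hεA hκA hKA hm₀ hmA hRσ hnB hdm

end Literature.MathematicalPhysics.QuantumFieldTheory.Balaban1983to89.B13ConditionedWitness

end
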